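import Literature.MathematicalPhysics.QuantumFieldTheory.CvitanovicKinoshita1974.SubdiagramUVLimits
import HarnessLib

/-!
# The fourth-order self-energy insertion `M_4b ⊃ S_{2b}`: the printed parametric functions (AKN 2019 eqs. (60), (61)) from an `S_{2b}`-adapted loop matrix, and their UV/IR limits (C-K 1974 II (2.14), (2.17), (4.24), (4.30)) in closed form — a kernel-checked reference case

independent recomputation; certified where stated, statistical where stated; no new-physics claim.

HONEST FRAMING (venture `QEDPrecision`, cell `qed-hepp`, seat `qed-hepp-lit` gen 3; VALUE-FREE: polynomial identities in five rational parameters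
`z₁, z₂, z₃, z_a, z_b`; no integral, no number of any Set-V family). Purpose: `BuildingBlockUVLimits`, `SubdiagramIRLimits`, `SubdiagramUVLimits` are
stated for ARBITRARY `S`-adapted loop-matrix blocks and leave the graph dictionary informal. This file instantiates them on the cell's STEP-0 word `abba`
= the fourth-order diagram `M_4b` with its second-order self-energy subdiagram `S_{2b} = {2, b}` (the cell's «4b», BOUNDEDNESS.md §7: «S = S2b = {2, b};
adjacent leptons 1, 3; quotient a*a»), checks the dictionary against the PRINTED `U`, `B_ij` of `M_4b`, and writes the UV and IR leading coefficients
in closed form.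

SOURCES, AS PRINTED. [AoyamaKinoshitaNio2019] T. Aoyama, T. Kinoshita, M. Nio, Atoms 7 (2019) 28, §4.3: «For M_4b, the independent circuits c₁ and c₂
consist of two lines l₁ = z₁ + z₃ + z_a and l₂ = z₂ and two lines l₂ = z₂ and l₃ = z_b, respectively», (60) «U = z_{13a} z₂ + z_{13a} z_b + z₂ z_b»,
(61) «B₁₁ = B₁₃ = B₃₃ = z₂ + z_b, B₁₂ = B₂₃ = z_b, B₂₂ = z_b + z_{13a}», (55)–(57) «A_i = 1 − Σ_j z_j B_ij/U», «V = z₁ + ⋯ + z_{2n−1} − G», «G = Σ z_i A_i»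
(«we set m² = p² = 1 and the photon mass λ = 0»); §4.6 (84) «Δ′M_4b = (1 − K₂) M_4b = M_4b − δm₂^UV M₂* − B₂^UV M₂» (the subdiagram `S₂ = S_{2b}`), §4.7
(90) «ΔM_4b = (1 − R₂ − I₁₃) Δ′M_4b» (typed as symbols in `AoyamaKinoshitaNio2019.FourthOrderWorkedExample`; the functions (60), (61) in
`ParametricBuildingBlocks` as `U4b`, `B4b`). [CvitanovicKinoshita1974b] §II B (2.14), (2.17); §IV (4.23)–(4.30) (see `SubdiagramIRLimits`,
`SubdiagramUVLimits`).

THE DICTIONARY, INSTANTIATED. Circuits: inner `κI = {c_b}` (`c_b` = photon `b` + lepton 2, inside `S`), outer `κO = {c_a}` (`c_a` = photon `a` + leptons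
1, 2, 3; it passes THROUGH `S` along lepton 2). Lines of `S`: `μS = {2, b}` (`Fin 2`: `0 ↦ 2`, `1 ↦ b`); soft lines of `G/S`: `μE = {1, 3}`; hard: `μH = {a}`.
Blocks: `TI = (1 1)`, `TOS = (1 0)`, `TOO = (1 1 | 1)`; momentum-path incidence `η = χS = (1, 0)` on `S`, `χE = (1, 1)`, `0` on `a`. This is the
printed circuit set of (51) with AKN's merged line `l₁ = z₁ + z₃ + z_a` resolved into its three propagators (so that the IR scaling, which separates
`z₁, z₃` from `z_a`, can act).

PROVED (kernel, `ring`/`simp` on 1×1 and 2×2 determinants):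
* `M4b.pathAdapted` — the set is path-adapted with insertion line `1` (`PathAdapted TOS TOO (inl 0) η`);
* `M4b.UDet_eq_U4b` — `U` of the adapted blocks IS the printed (60) (`= U4b`); `M4b.cofBO_zero_eq` — the mixed coefficient of (2.14) is `z_b`, the
  printed `B₁₂ = B₂₃ = z_b` of (61) (`= B4b 0 1`), exactly (here `n_S = 1` and `B₁₂(ε) = ε·z_b` has no higher terms);
* UV (2.17): `M4b.uvV_zero_eq` — on shell `[U·V]^{S}_UV = (z₂ + z_b)·(z₁ + z₃)²` = `U^S · (U V)^{G/S}` with `(U V)^{G/S} = (z₁ + z₃)²` the on-shell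
  numerator of the reduced diagram `M₂*`-type `{1, 3, a}`;
* IR (4.24), (4.30): `M4b.irU_zero_eq` — `[U]_IR = (z₂ + z_b)·z_a`; `M4b.irG_zero_eq` — `[U·V]_IR = z_a·z₂² + (z₂ + z_b)·(z₁ + z₃)²`; hence
  `M4b.V_ir_eq` — `[V]_IR = z₂²/(z₂ + z_b) + (z₁ + z₃)²/z_a = V_{S_{2b}} + [V_{G/S}]_IR` (the on-shell `V` of the one-loop self-energy `{2, b}` plus
  the IR-leading `V` of `{1, 3, a}`), for `z₂ + z_b ≠ 0`, `z_a ≠ 0`.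
NOT CLAIMED: anything about the integrals `M_4b`, `ΔM_4b`; the general graph dictionary.
-/

namespace Literature.MathematicalPhysics.QuantumFieldTheory.CvitanovicKinoshita1974

open Matrix Finset
open Literature.MathematicalPhysics.QuantumFieldTheory.AoyamaEtAl2006
open Literature.MathematicalPhysics.QuantumFieldTheory.AoyamaKinoshitaNio2019 (Params4 U4b B4b)

namespace M4b

variable (z : Params4)

/-- Inner circuit `c_b` of `S_{2b}` on the lines of `S` (`0 ↦` lepton 2, `1 ↦` photon `b`): `ξ = (1, 1)`. [cite: AoyamaKinoshitaNio2019, §4.3 eq. (51) (circuit c₂ of M_4b)] -/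
def TI : Matrix (Fin 1) (Fin 2) ℤ := !![1, 1]

/-- Outer circuit `c_a` on the lines of `S`: it uses lepton 2, not photon `b`: `ξ = (1, 0)`. [cite: AoyamaKinoshitaNio2019, §4.3 eq. (51) (circuit c₁ of M_4b)] -/
def TOS : Matrix (Fin 1) (Fin 2) ℤ := !![1, 0]

/-- Outer circuit `c_a` on the lines of `G/S` (soft: leptons 1, 3; hard: photon `a`): all `1` — AKN's merged line `l₁ = z₁ + z₃ + z_a`.
[cite: AoyamaKinoshitaNio2019, §4.3 (text before eq. (50))] -/
def TOO : Matrix (Fin 1) (Fin 2 ⊕ Fin 1) ℤ := Matrix.of fun _ _ => 1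

/-- Parameters of `S = {2, b}`. [cite: AoyamaKinoshitaNio2019, §4.3] -/
def zS : Fin 2 → ℚ := ![z.z2, z.zb]

/-- Soft parameters of `G/S`: the leptons 1, 3 adjacent to `S`. [cite: AoyamaKinoshitaNio2019, §4.3] -/
def zE : Fin 2 → ℚ := ![z.z1, z.z3]

/-- Hard parameter of `G/S`: the photon `a`. [cite: AoyamaKinoshitaNio2019, §4.3] -/
def zH : Fin 1 → ℚ := ![z.za]

/-- The external-momentum path inside `S`: through lepton 2, not photon `b`. [cite: CvitanovicKinoshita1974a, §IV F (path through the insertion)] -/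
def η : Fin 2 → ℤ := ![1, 0]

/-- The path incidence on the soft lines (both leptons carry `p`). [cite: CvitanovicKinoshita1974b, §IV A (P^e)] -/
def χE : Fin 2 → ℚ := ![1, 1]

/-- The (rational) path incidence on `S`. [cite: CvitanovicKinoshita1974a, §IV F] -/
def χS : Fin 2 → ℚ := fun b => (η b : ℚ)

/-- All parameters of `M_4b` in the `S ⊕ (soft ⊕ hard)` indexing (= the IR point at `λ = 1`). [cite: AoyamaKinoshitaNio2019, §4.3] -/
def zAll : Fin 2 ⊕ (Fin 2 ⊕ Fin 1) → ℚ := Sum.elim (zS z) (Sum.elim (zE z) (zH z))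

/-- **Path-adaptedness** of this circuit set with insertion line `1` (= `Sum.inl 0`): `ξ_{b, c_a} = ξ_{1, c_a} · η_b`.
[cite: CvitanovicKinoshita1974b, §II B eq. (2.14) (hypothesis «S inserted in the line i of G/S»)] -/
theorem pathAdapted : PathAdapted TOS TOO (Sum.inl 0 : Fin 2 ⊕ Fin 1) η := by
  intro t b
  fin_cases t
  fin_cases b <;> rfl

/-! ### Entries of the 1×1 blocks -/

/-- `U^S_st = z₂ + z_b` (the one-loop `U` of `S_{2b}`). [cite: AoyamaKinoshitaNio2019, §4.3 eq. (52)] -/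
theorem UMat_TI (s t : Fin 1) : UMat TI (zS z) s t = z.z2 + z.zb := by
  fin_cases s; fin_cases t
  simp [UMat, TI, zS, Fin.sum_univ_two]

/-- `U^{G/S}_st (soft λ·(z₁, z₃), hard z_a) = λ z₁ + λ z₃ + z_a`. [cite: AoyamaKinoshitaNio2019, §4.3 eq. (52)] -/
theorem UMat_TOO (lam : ℚ) (s t : Fin 1) : UMat TOO (outerZ (zE z) (zH z) lam) s t = lam * z.z1 + lam * z.z3 + z.za := by
  fin_cases s; fin_cases t
  simp [UMat, TOO, outerZ, zE, zH, Fintype.sum_sum_type, Fin.sum_univ_two]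

/-- `U^{OS}_st = z₂`. [cite: AoyamaKinoshitaNio2019, §4.3 eq. (52)] -/
theorem UMat_TOS (s t : Fin 1) : UMat TOS (zS z) s t = z.z2 := by
  fin_cases s; fin_cases t
  simp [UMat, TOS, zS, Fin.sum_univ_two]

/-- The cross block `X = z₂`. [cite: AoyamaEtAl2006, §3.3] -/
theorem crossMat_eq (s t : Fin 1) : crossMat TI TOS (zS z) s t = z.z2 := by
  fin_cases s; fin_cases t
  simp [crossMat, TI, TOS, zS, Fin.sum_univ_two]

/-- A `2 × 2` determinant indexed by `Fin 1 ⊕ Fin 1`. [folklore] -/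
private theorem det_fromBlocks_fin_one (a b c d : Matrix (Fin 1) (Fin 1) ℚ) :
    (fromBlocks a b c d).det = a 0 0 * d 0 0 - b 0 0 * c 0 0 := by
  rw [← det_reindex_self finSumFinEquiv, det_fin_two]
  have h0 : (finSumFinEquiv.symm (0 : Fin 2) : Fin 1 ⊕ Fin 1) = Sum.inl 0 := by decide
  have h1 : (finSumFinEquiv.symm (1 : Fin 2) : Fin 1 ⊕ Fin 1) = Sum.inr 0 := by decide
  simp [reindex_apply, h0, h1]

/-! ### The dictionary checked against the printed `U`, `B₁₂` of `M_4b` -/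

/-- The parameter vector is the IR point at scale `λ = 1`. [cite: CvitanovicKinoshita1974b, §IV eq. (4.23)] -/
theorem irZ_one : irZ (zS z) (zE z) (zH z) 1 = zAll z := by
  funext c
  rcases c with b | e | h <;> simp [irZ, scaledZ, outerZ, zAll]

/-- **`U` of the adapted blocks is the printed (60)**: `U = z_{13a} z₂ + z_{13a} z_b + z₂ z_b`. [cite: AoyamaKinoshitaNio2019, §4.3 eq. (60)] -/
theorem UDet_eq_U4b : UDet (adaptedT TI TOS TOO) (zAll z) = U4b z := by
  rw [← irZ_one, UDet_ir, irU, cofMat, det_fromBlocks_fin_one]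
  simp only [one_pow, one_mul, one_smul, Matrix.add_apply, Matrix.smul_apply, Matrix.transpose_apply, UMat_TI, UMat_TOO, UMat_TOS, crossMat_eq,
    smul_eq_mul, U4b]
  ring

/-- **The mixed coefficient of (2.14) is the printed `B₁₂ = z_b` of (61)**: `cofBO(0) (2, c) = B^{G/S}_{1c} · (U^S A^S₂) = 1 · ((z₂ + z_b) − z₂) = z_b`
for every outer line `c`. [cite: CvitanovicKinoshita1974b, §II B eq. (2.14); AoyamaKinoshitaNio2019 §4.3 eq. (61)] -/
theorem cofBO_zero_eq (c : Fin 2 ⊕ Fin 1) :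
    cofBO TI TOS TOO (zS z) (Sum.elim (zE z) (zH z)) 0 (Sum.inl 0) c = z.zb := by
  rw [cofBO_zero_inl_of_pathAdapted TI TOS TOO (zS z) _ pathAdapted]
  simp [BAdj, ANum, UDet, UMat, adjugate_subsingleton, det_unique, TOO, TI, zS, η, Fin.sum_univ_two]

/-- The printed `B₁₂` of `M_4b` is `z_b`. [cite: AoyamaKinoshitaNio2019, §4.3 eq. (61)] -/
theorem B4b_one_two : B4b z 0 1 = z.zb := by
  simp [B4b]

/-! ### The UV limit of `S_{2b}` (C-K II (2.17)) -/

/-- On-shell masses: `m_i² = χ_i²` (units `m = 1`): leptons `1`, photons `0`. [cite: AoyamaKinoshitaNio2019, §4.1 («m² = p² = 1, λ = 0»)] -/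
def msq : Fin 2 ⊕ (Fin 2 ⊕ Fin 1) → ℚ := fun c => uvχ χS (outerχ χE) c * uvχ χS (outerχ χE) c

/-- **(2.17) for `M_4b ⊃ S_{2b}`, closed form**: `[U·V]^{S}_UV = U^S · (U V)^{G/S} = (z₂ + z_b) · (z₁ + z₃)²` on shell — the reduced diagram's
on-shell numerator is `(z₁ + z₃)²` (its `V = (z₁ + z₃)²/(z₁ + z₃ + z_a)`). [cite: CvitanovicKinoshita1974b, §II B eq. (2.17)] -/
theorem uvV_zero_eq : uvV TI TOS TOO (zS z) (Sum.elim (zE z) (zH z)) χS (outerχ χE) msq 1 0 = (z.z2 + z.zb) * (z.z1 + z.z3) ^ 2 := by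
  rw [uvV_zero, VNum_onShell _ _ _ _ 1 (fun c => by simp [msq, uvχ])]
  have hU : UDet TI (zS z) = z.z2 + z.zb := by rw [UDet, det_unique, UMat_TI]
  have hG : GQuad TOO (Sum.elim (zE z) (zH z)) (outerχ χE) = (z.z1 + z.z3) ^ 2 := by
    rw [GQuad, adjugate_subsingleton, Matrix.one_mulVec]
    simp [dotProduct, WVec_apply, TOO, outerχ, χE, zE, zH, Fintype.sum_sum_type, Fin.sum_univ_two]
    ring
  rw [hU, hG, one_mul]

/-! ### The IR limit of `S_{2b}` (C-K II (4.24), (4.30); AHKN «U → U_S U_R, V → V_S + V_R») -/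

/-- **(4.24) for `M_4b`**: `[U]_IR = U^S · [U^{G/S}]_IR = (z₂ + z_b) · z_a`. [cite: CvitanovicKinoshita1974b, §IV eq. (4.24)] -/
theorem irU_zero_eq : irU TI TOS TOO (zS z) (zE z) (zH z) 0 = (z.z2 + z.zb) * z.za := by
  rw [irU_zero, UDet, UDet, det_unique, det_unique, UMat_TI, UMat_TOO]
  ring

/-- **(4.30) for `M_4b`, numerator**: `[U·V]_IR = [U^{G/S}]_IR · (U^S V_S) + U^S · [U^{G/S} V_{G/S}]_IR = z_a · z₂² + (z₂ + z_b) · (z₁ + z₃)²`.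
[cite: CvitanovicKinoshita1974b, §IV eq. (4.30)] -/
theorem irG_zero_eq : irG TI TOS TOO (zS z) (zE z) (zH z) χS χE 0 = z.za * z.z2 ^ 2 + (z.z2 + z.zb) * (z.z1 + z.z3) ^ 2 := by
  rw [irG_zero]
  have hU : UDet TI (zS z) = z.z2 + z.zb := by rw [UDet, det_unique, UMat_TI]
  have hUR : UDet TOO (outerZ (zE z) (zH z) 0) = z.za := by rw [UDet, det_unique, UMat_TOO]; ring
  have hGS : GQuad TI (zS z) χS = z.z2 ^ 2 := by
    rw [GQuad, adjugate_subsingleton, Matrix.one_mulVec]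
    simp [dotProduct, WVec_apply, TI, χS, η, zS, Fin.sum_univ_two]
    ring
  have hGR : outerG TOO (zE z) (zH z) χE 0 = (z.z1 + z.z3) ^ 2 := by
    rw [outerG, adjugate_subsingleton, Matrix.one_mulVec]
    simp [dotProduct, softW, mulVec, TOO, χE, zE, Fintype.sum_sum_type, Fin.sum_univ_two]
    ring
  rw [hU, hUR, hGS, hGR]

/-- **(4.30) for `M_4b`**: `[V]_IR = z₂²/(z₂ + z_b) + (z₁ + z₃)²/z_a = V_{S_{2b}} + [V_{G/S}]_IR` — the on-shell `V` of the one-loop self-energy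
`{2, b}` plus the IR-leading `V` of the reduced diagram `{1, 3, a}` («V separates into the S and G/S parts of the same order»).
[cite: CvitanovicKinoshita1974b, §IV eq. (4.30); AoyamaHayakawaKinoshitaNio2008 §3 («V → V_S + V_R»)] -/
theorem V_ir_eq (hS : z.z2 + z.zb ≠ 0) (ha : z.za ≠ 0) :
    irG TI TOS TOO (zS z) (zE z) (zH z) χS χE 0 / irU TI TOS TOO (zS z) (zE z) (zH z) 0 =
      z.z2 ^ 2 / (z.z2 + z.zb) + (z.z1 + z.z3) ^ 2 / z.za := by
  rw [irG_zero_eq, irU_zero_eq]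
  field_simp

end M4b

end Literature.MathematicalPhysics.QuantumFieldTheory.CvitanovicKinoshita1974
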